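import Summits.HodgeConjecture.HodgeConjecture.Theorems.Ring2WeilCoverageNormCriteria
import Summits.HodgeConjecture.HodgeConjecture.Theorems.Ring2WeilNormObstructionDescentCensus
import HarnessLib

/-!
# Weil-type family coverage — a third engine on the product-window data (`C₄ × S₃` on R3, `GL₂(3) × F₂₀` on W6.2.5, `C₆ × F₂₀` on R2, `C₄ × AGL(1,7)` on W6.1.7; `PSL₂(7) × S₃` on W6.7.3 if its run ends in session) (ring2-b02, gen 61)

research route conditional on HC_CM; not a corollary; Q11.4-sentence-2 already refuted in dim ≥ 3.

Ring 2, WEIL-TYPE FAMILY-COVERAGE CENSUS (`HOME/WEIL-FAMILY-COVERAGE.md` `## b02 (g = 6)`, block b02.21, owner ring2-b02).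
Block b02.21 proves THEOREM X (the discriminant law `a_B ≡ ∏_j disc(h|moving c_j) · |∏_j det_K((ρ(c_j)-1)|moving)|`
mod `Nm Kˣ` for every Schur-index-one window) as a seat-derived structure theorem and folds it over 802 exact
period computations; that law is NOT a kernel statement.  THIS FILE pins the arithmetic of the exact `det H` values
which this seat's Morita-reduced fatgraph engine (`smono.py` + `prodwin_b02.py`, a third engine after ring2-b04's
Galois/coset engines and ring2-b06's coset engine) returns on ring2-b04's four two-parameter `C₄ × S₃`-families of
b04.13 (C) (`K = ℚ(i)` through the faithful character of `C₄`, hidden factor a `(3,3)` Weil-type sixfold):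
`det H = -8/3⁹, -4/3⁹, -4/3⁹, -2/3⁹` for `(0; c1:2, c1:3, c1:e, c2:e, c3:2)`, `(0; c1:2, c1:2, c1:3, c2:e, c3:3)`,
`(0; c1:2, c1:2, c1:e, c2:3, c3:e)`, `(0; c1:2, c1:3, c1:e, c2:3, c3:2)` (genus 21, 23, 23, 25).  Each class is
`[-3] ∈ ℚˣ/Nm(ℚ(i)ˣ)`, which is NOT the split class `[(-1)³]`: row W6.1.3 = `(3, ℚ(i), a ≡ 3)` = pub-hsemireg's R3,
agreeing with ring2-b04's values `-32/243, -16/27, -64/27, -320/27` (same classes, other normalisations of the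
polarisation) — the non-split statement is the cell's `negThree_ne_split_one_of_odd` (uniform 3-descent, gen 49).
The monodromy of all four families is Zariski-dense in `SU(3,3)` by two certificates of the census (LEMMA AS and the
unipotent Lie closure); that, and THEOREM X, are exact computations / structure theorems of the census, not kernel facts.

No `def`, no named fact, no `sorry`; nothing here is a statement about Hodge classes; `HC_CM` is used nowhere.

References: [cite: vanGeemen1994HodgeAV, 5.2 and (5.4.1)].
-/

noncomputable section

set_option linter.dupNamespace false

open Literature.AlgebraicGeometry.Motives
open Literature.AlgebraicGeometry.VanGeemen1994
open Summit.HodgeConjecture.HodgeConjecture.Ring2.Hypotheses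
open Summit.HodgeConjecture.Ring2WeilNormDescent

namespace Summit.HodgeConjecture.HodgeConjecture.Ring2.WeilCoverage

/-! ### `C₄ × S₃` on R3 = W6.1.3 = `(3, ℚ(i), a ≡ 3)` — the third engine's literal determinants -/

/-- **`(0; c1:2, c1:3, c1:e, c2:e, c3:2)` (genus 21; one Hurwitz orbit of 720 tuples; `ℚ(i)`-signature `(3,3)`): literal `det H = -8/3⁹ = -8/19683`; `(-8/19683)⁻¹·(-3) = 3¹⁰/8 = (243/4)² + (243/4)²` is a norm from `ℚ(i)`, so the class is `[-3]`.**
research route conditional on HC_CM; not a corollary; Q11.4-sentence-2 already refuted in dim ≥ 3. [cite: vanGeemen1994HodgeAV, (5.4.1)] -/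
theorem c4xS3_family_2_3_e_e_2_mk_detH_eq_negThree :
    (QuotientGroup.mk (Units.mk0 ((-8 : ℚ) / 19683) (by norm_num)) : weilNormResidueGroup 1) =
      QuotientGroup.mk (Units.mk0 (-3 : ℚ) (by norm_num)) := by
  rw [QuotientGroup.eq]
  have e : (Units.mk0 ((-8 : ℚ) / 19683) (by norm_num))⁻¹ * Units.mk0 (-3 : ℚ) (by norm_num) =
      Units.mk0 ((59049 : ℚ) / 8) (by norm_num) := Units.ext (by norm_num)
  rw [e]
  exact mem_normUnitsSubgroup_of_sq_add_mul_sq _ ((243 : ℚ) / 4) ((243 : ℚ) / 4) (by norm_num)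

/-- … hence NOT the split class `[(-1)³]` of `(3, ℚ(i))` (`negThree_ne_split_one_of_odd`: `3 ∉ Nm(ℚ(i)ˣ)`).
research route conditional on HC_CM; not a corollary; Q11.4-sentence-2 already refuted in dim ≥ 3. [cite: vanGeemen1994HodgeAV, (5.4.1)] -/
theorem c4xS3_family_2_3_e_e_2_mk_detH_ne_split :
    (QuotientGroup.mk (Units.mk0 ((-8 : ℚ) / 19683) (by norm_num)) : weilNormResidueGroup 1) ≠
      splitDiscriminantClass 3 1 := by
  rw [c4xS3_family_2_3_e_e_2_mk_detH_eq_negThree]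
  exact negThree_ne_split_one_of_odd (by decide)

/-- **`(0; c1:2, c1:2, c1:3, c2:e, c3:3)` (genus 23; 720 tuples, one orbit) and `(0; c1:2, c1:2, c1:e, c2:3, c3:e)` (genus 23; 360 tuples, one orbit): literal `det H = -4/3⁹`; `(-4/19683)⁻¹·(-3) = 3¹⁰/4 = (243/2)²`, class `[-3]`.**
research route conditional on HC_CM; not a corollary; Q11.4-sentence-2 already refuted in dim ≥ 3. [cite: vanGeemen1994HodgeAV, (5.4.1)] -/
theorem c4xS3_families_genus23_mk_detH_eq_negThree :
    (QuotientGroup.mk (Units.mk0 ((-4 : ℚ) / 19683) (by norm_num)) : weilNormResidueGroup 1) =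
      QuotientGroup.mk (Units.mk0 (-3 : ℚ) (by norm_num)) := by
  rw [QuotientGroup.eq]
  have e : (Units.mk0 ((-4 : ℚ) / 19683) (by norm_num))⁻¹ * Units.mk0 (-3 : ℚ) (by norm_num) =
      Units.mk0 ((59049 : ℚ) / 4) (by norm_num) := Units.ext (by norm_num)
  rw [e]
  exact mem_normUnitsSubgroup_of_sq_add_mul_sq _ ((243 : ℚ) / 2) (0 : ℚ) (by norm_num)

/-- … hence NOT the split class of `(3, ℚ(i))`.
research route conditional on HC_CM; not a corollary; Q11.4-sentence-2 already refuted in dim ≥ 3. [cite: vanGeemen1994HodgeAV, (5.4.1)] -/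
theorem c4xS3_families_genus23_mk_detH_ne_split :
    (QuotientGroup.mk (Units.mk0 ((-4 : ℚ) / 19683) (by norm_num)) : weilNormResidueGroup 1) ≠
      splitDiscriminantClass 3 1 := by
  rw [c4xS3_families_genus23_mk_detH_eq_negThree]
  exact negThree_ne_split_one_of_odd (by decide)

/-- **`(0; c1:2, c1:3, c1:e, c2:3, c3:2)` (genus 25; 1440 tuples, one orbit): literal `det H = -2/3⁹`; `(-2/19683)⁻¹·(-3) = 3¹⁰/2 = (243/2)² + (243/2)²`, class `[-3]`.**
research route conditional on HC_CM; not a corollary; Q11.4-sentence-2 already refuted in dim ≥ 3. [cite: vanGeemen1994HodgeAV, (5.4.1)] -/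
theorem c4xS3_family_2_3_e_3_2_mk_detH_eq_negThree :
    (QuotientGroup.mk (Units.mk0 ((-2 : ℚ) / 19683) (by norm_num)) : weilNormResidueGroup 1) =
      QuotientGroup.mk (Units.mk0 (-3 : ℚ) (by norm_num)) := by
  rw [QuotientGroup.eq]
  have e : (Units.mk0 ((-2 : ℚ) / 19683) (by norm_num))⁻¹ * Units.mk0 (-3 : ℚ) (by norm_num) =
      Units.mk0 ((59049 : ℚ) / 2) (by norm_num) := Units.ext (by norm_num)
  rw [e]
  exact mem_normUnitsSubgroup_of_sq_add_mul_sq _ ((243 : ℚ) / 2) ((243 : ℚ) / 2) (by norm_num)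

/-- … hence NOT the split class of `(3, ℚ(i))`.
research route conditional on HC_CM; not a corollary; Q11.4-sentence-2 already refuted in dim ≥ 3. [cite: vanGeemen1994HodgeAV, (5.4.1)] -/
theorem c4xS3_family_2_3_e_3_2_mk_detH_ne_split :
    (QuotientGroup.mk (Units.mk0 ((-2 : ℚ) / 19683) (by norm_num)) : weilNormResidueGroup 1) ≠
      splitDiscriminantClass 3 1 := by
  rw [c4xS3_family_2_3_e_3_2_mk_detH_eq_negThree]
  exact negThree_ne_split_one_of_odd (by decide)

/-- **All four `C₄ × S₃` R3 determinants of the third engine lie in ONE class, `[-3]` (same row W6.1.3 as ring2-b04's `-32/243`: `(-32/243)⁻¹·(-3) = 729/32 = (27/8)² + (27/8)²`).**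
research route conditional on HC_CM; not a corollary; Q11.4-sentence-2 already refuted in dim ≥ 3. [cite: vanGeemen1994HodgeAV, (5.4.1)] -/
theorem b04_c4xS3_value_mk_eq_negThree :
    (QuotientGroup.mk (Units.mk0 ((-32 : ℚ) / 243) (by norm_num)) : weilNormResidueGroup 1) =
      QuotientGroup.mk (Units.mk0 (-3 : ℚ) (by norm_num)) := by
  rw [QuotientGroup.eq]
  have e : (Units.mk0 ((-32 : ℚ) / 243) (by norm_num))⁻¹ * Units.mk0 (-3 : ℚ) (by norm_num) =
      Units.mk0 ((729 : ℚ) / 32) (by norm_num) := Units.ext (by norm_num)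
  rw [e]
  exact mem_normUnitsSubgroup_of_sq_add_mul_sq _ ((27 : ℚ) / 8) ((27 : ℚ) / 8) (by norm_num)

/-! ### `GL₂(3) × F₂₀` on W6.2.5 = `(3, ℚ(√-2), a ≡ 5)` — the third engine on ring2-b04/b06's rigid ℚ(√-2) sixfold -/

/-- **the rigid `GL₂(3) × F₂₀`-curve `(0; 2:4A, 3:4A, 8A:22)` (genus 261; ring2-b06 b06.20 P.S. 14 / ring2-b04 b04.13 P.S. 6; `K = ℚ(√-2)` through `χ₂ ⊗ (perm − 1)`, `d = 8`): this seat's fatgraph engine finds 480 admissible tuples in ONE Hurwitz orbit, hidden factor of dimension 6, `ℚ(√-2)`-signature `(3,3)`, literal `det H = -32/1537734375 = -2⁵/(3⁹·5⁷)`; `(-32/1537734375)⁻¹·(-5) = 3⁹5⁸/2⁵ = (50625/4)² + 2·(50625/8)²` is a norm from `ℚ(√-2)`, so the class is `[-5]` — the same class as ring2-b06's `-2⁸3⁵5` and ring2-b04's coset value, and as THEOREM X's class-table prediction.**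
research route conditional on HC_CM; not a corollary; Q11.4-sentence-2 already refuted in dim ≥ 3. [cite: vanGeemen1994HodgeAV, (5.4.1)] -/
theorem gl23xF20_rigid_24A_34A_8A22_mk_detH_eq_negFive :
    (QuotientGroup.mk (Units.mk0 ((-32 : ℚ) / 1537734375) (by norm_num)) : weilNormResidueGroup 2) =
      QuotientGroup.mk (Units.mk0 (-5 : ℚ) (by norm_num)) := by
  rw [QuotientGroup.eq]
  have e : (Units.mk0 ((-32 : ℚ) / 1537734375) (by norm_num))⁻¹ * Units.mk0 (-5 : ℚ) (by norm_num) =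
      Units.mk0 ((7688671875 : ℚ) / 32) (by norm_num) := Units.ext (by norm_num)
  rw [e]
  exact mem_normUnitsSubgroup_of_sq_add_mul_sq _ ((50625 : ℚ) / 4) ((50625 : ℚ) / 8) (by norm_num)

/-- … hence NOT the split class `[(-1)³]` of `(3, ℚ(√-2))`: the factor lies on the NON-split row W6.2.5 (`negFive_ne_split_two_of_odd`: `5 ∉ Nm(ℚ(√-2)ˣ)`, descent at the inert prime 5).
research route conditional on HC_CM; not a corollary; Q11.4-sentence-2 already refuted in dim ≥ 3. [cite: vanGeemen1994HodgeAV, (5.4.1)] -/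
theorem gl23xF20_rigid_24A_34A_8A22_mk_detH_ne_split :
    (QuotientGroup.mk (Units.mk0 ((-32 : ℚ) / 1537734375) (by norm_num)) : weilNormResidueGroup 2) ≠
      splitDiscriminantClass 3 2 := by
  rw [gl23xF20_rigid_24A_34A_8A22_mk_detH_eq_negFive]
  exact negFive_ne_split_two_of_odd (by decide)

/-! ### `C₆ × F₂₀` on R2 = W6.3.5 = `(3, ℚ(√-3), a ≡ 5)` — the genus-71 family ring2-b06's Lie route could not certify -/

/-- **the one-parameter `C₆ × F₂₀`-family `(0; c0:22, c1:22, c1:4A, c4:4B)` (genus 71; ring2-b04 b04.13 (B), value `-7168/135`): this seat's engine finds ONE Hurwitz orbit (2880), hidden factor `(3,3)`, literal `det H = -16/234375 = -2⁴/(3·5⁷)`; `(-16/234375)⁻¹·(-5) = 3·5⁸/2⁴ = 0² + 3·(625/4)²` is a norm from `ℚ(√-3)`, class `[-5]` — R2; its monodromy has NO unipotent element but is Zariski-dense in `SU(3,3)` by LEMMA AS (census b02.21.4 (C); a computation, not a kernel fact).**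
research route conditional on HC_CM; not a corollary; Q11.4-sentence-2 already refuted in dim ≥ 3. [cite: vanGeemen1994HodgeAV, (5.4.1)] -/
theorem c6xF20_family_g71_mk_detH_eq_negFive :
    (QuotientGroup.mk (Units.mk0 ((-16 : ℚ) / 234375) (by norm_num)) : weilNormResidueGroup 3) =
      QuotientGroup.mk (Units.mk0 (-5 : ℚ) (by norm_num)) := by
  rw [QuotientGroup.eq]
  have e : (Units.mk0 ((-16 : ℚ) / 234375) (by norm_num))⁻¹ * Units.mk0 (-5 : ℚ) (by norm_num) =
      Units.mk0 ((1171875 : ℚ) / 16) (by norm_num) := Units.ext (by norm_num)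
  rw [e]
  exact mem_normUnitsSubgroup_of_sq_add_mul_sq _ (0 : ℚ) ((625 : ℚ) / 4) (by norm_num)

/-- … hence NOT the split class of `(3, ℚ(√-3))` (`negFive_ne_split_three_of_odd`: `5 ∉ Nm(ℚ(√-3)ˣ)`).
research route conditional on HC_CM; not a corollary; Q11.4-sentence-2 already refuted in dim ≥ 3. [cite: vanGeemen1994HodgeAV, (5.4.1)] -/
theorem c6xF20_family_g71_mk_detH_ne_split :
    (QuotientGroup.mk (Units.mk0 ((-16 : ℚ) / 234375) (by norm_num)) : weilNormResidueGroup 3) ≠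
      splitDiscriminantClass 3 3 := by
  rw [c6xF20_family_g71_mk_detH_eq_negFive]
  exact negFive_ne_split_three_of_odd (by decide)

/-! ### `C₄ × AGL(1,7)` on W6.1.7 = `(3, ℚ(i), a ≡ 7)` — the genus-71 family ring2-b06's Lie route could not certify -/

/-- **the one-parameter `C₄ × AGL(1,7)`-family `(0; c0:222, c1:6A, c1:6B, c2:222)` (genus 71; ring2-b04 b04.13, value `-729/7`): this seat's engine finds ONE Hurwitz orbit (8064), hidden factor `(3,3)`, literal `det H = -2/823543 = -2/7⁷`; `(-2/823543)⁻¹·(-7) = 7⁸/2 = (2401/2)² + (2401/2)²` is a norm from `ℚ(i)`, class `[-7]` — row W6.1.7; no unipotent in its monodromy, yet Zariski-dense in `SU(3,3)` by LEMMA AS (census b02.21.4 (C); a computation, not a kernel fact).**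
research route conditional on HC_CM; not a corollary; Q11.4-sentence-2 already refuted in dim ≥ 3. [cite: vanGeemen1994HodgeAV, (5.4.1)] -/
theorem c4xAGL17_family_g71_mk_detH_eq_negSeven :
    (QuotientGroup.mk (Units.mk0 ((-2 : ℚ) / 823543) (by norm_num)) : weilNormResidueGroup 1) =
      QuotientGroup.mk (Units.mk0 (-7 : ℚ) (by norm_num)) := by
  rw [QuotientGroup.eq]
  have e : (Units.mk0 ((-2 : ℚ) / 823543) (by norm_num))⁻¹ * Units.mk0 (-7 : ℚ) (by norm_num) =
      Units.mk0 ((5764801 : ℚ) / 2) (by norm_num) := Units.ext (by norm_num)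
  rw [e]
  exact mem_normUnitsSubgroup_of_sq_add_mul_sq _ ((2401 : ℚ) / 2) ((2401 : ℚ) / 2) (by norm_num)

/-- … hence NOT the split class of `(3, ℚ(i))` (`negSeven_ne_split_one_of_odd`: `7 ∉ Nm(ℚ(i)ˣ)`).
research route conditional on HC_CM; not a corollary; Q11.4-sentence-2 already refuted in dim ≥ 3. [cite: vanGeemen1994HodgeAV, (5.4.1)] -/
theorem c4xAGL17_family_g71_mk_detH_ne_split :
    (QuotientGroup.mk (Units.mk0 ((-2 : ℚ) / 823543) (by norm_num)) : weilNormResidueGroup 1) ≠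
      splitDiscriminantClass 3 1 := by
  rw [c4xAGL17_family_g71_mk_detH_eq_negSeven]
  exact negSeven_ne_split_one_of_odd (by decide)

end Summit.HodgeConjecture.HodgeConjecture.Ring2.WeilCoverage

end
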